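import Literature.NumberTheory.LFunctions.Zhang2022.RepairDetShiftPSD
import Literature.NumberTheory.LFunctions.Zhang2022.RepairDetShiftPSDCertHalfFiveHalvesThree

/-!
# Zhang (2022) §18-margin repair rung, barrier extension (cell landau-siegel §E, row S-E-p5-6 = companion of
# S-E-p6-2), part 2/2: the E-010 slot DISCHARGED at a third detector —
# `Det.FormDetPSD (Det.shiftRecipe (1/2; 5/2, 3))` is a theorem

Y. Zhang, *Discrete mean estimates and the Landau–Siegel zero*, arXiv:2211.02515v1 [Zhang2022LandauSiegel] —
an unrefereed manuscript under adjudication. **WHAT THIS IS NOT: a claim about its Theorems 1–2, about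
Landau–Siegel zeros, about Parity, or about a repaired `Margin232`. The programme SEARCHES and TYPES; no claim
about Landau–Siegel zeros, Theorems 1–2 of arXiv:2211.02515 or a repaired Margin232 until a kernel theorem says so.**

`RepairDetShift` (p460173) decides the shift-detector family `Repair.familyDetShift` with the slot
`Det.FormDetPSD (Det.shiftRecipe b)` DISPLAYED; the slot is a tree theorem at the printed `b = (1,2,3)`
(`Det.formDetPSD_zhang` / `formDetPSD_shiftRecipe_std`) and at `b⋆ = (1/2; 2, 5/2)` (`Det.formDetPSD_shiftRecipe_bStar`,
`RepairDetShiftPSD`, ls-barrier-p6, p473995). Here it is PROVED at a THIRD sign-admissible triple,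
`b⋆⋆ = (1/2; 5/2, 3)` (`Det.SignAdmissible`, gap `k = 2`, first shift mid-gap, the pair at the TOP of the gap):
**`Det.formDetPSD_shiftRecipe_bStar2`**, so the family's verdict is UNCONDITIONAL there as well
(`Repair.detShift_verdict_bStar2`, `detShift_unconditional_bStar2`). Method = ls-barrier-p6's, verbatim
(`Det.formDetPSD_of_certificate` p468669 + `Det.certForm_eq_hermForm3` + `Det.hermForm3_nonneg_of_schur` p468938):
the explicit Hermitian `2 × 2` matrix polynomial `K(t)`, `t = 7πy/22`, of degree `6` of the data file
`RepairDetShiftPSDCertHalfFiveHalvesThree` — which is ls-barrier-num's EXACT rational certificate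
CERT-shift-1_2-5_2-3.json (4e06dc211d37f98f) transported into `certForm`'s coordinates, so that the two scalar
Schur conditions ARE barrier-num's certified numerators (`S11e = (5/6)·Wn₂₂ ≥ 59/256`, `DETe = (25/36)·det Wn ≥ 0`,
the latter by `Det.ShiftCertHalfFiveHalvesThree.detWn_nonneg`, p472346) — pivot `24/(5π) > 0`, and the boundary form
`bdForm` is the DIAGONAL positive form `π²(3/5)|a|² + (3/5)|b|²` (the transported certificate has `K(0) = −β + (3/10)I`,
so the `m_n`-coupling cancels exactly: `k₁₂(0) = π·m_n`). The recipe data at `b⋆⋆` are exact: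
`W(b⋆⋆) = (i/10, −5i/2, 12/5)` (`shiftW_bStar2`), moments `(m₀, m_s, m_n, m_b, m_bs, m_bn) =
(12/5 − 12i/5, 36/5 − 41i/5, 3 − 3i, 36/5 − 31i/5, 108/5 − 108i/5, 9 − 9i)`.

Currency (C3(e)): FormDet = formula I on ONE-SIDED kinked profiles (the slot's class); that the detector-`b⋆⋆`
constants ARE this form is E-det-main (open off `(1,2,3)`); nothing here is a statement about zeros. Certificate
ledger (C7′): the certificate is DATA checked by `ring`/`norm_num` in the kernel; no kit number enters a statement
(barrier-num's generator estar-S/cert_sos.py and the json are provenance only).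

References: Y. Zhang, arXiv:2211.02515v1 (2022), §2 (2.13), Lemma 2.3, (2.16); §7 Prop. 7.1 [p. 44]; §8 (8.11)–(8.23).
[cite: Zhang2022LandauSiegel, §2 Lemma 2.3; §7 Prop. 7.1; §8 (8.11)–(8.23)]
-/

noncomputable section

open Complex Real ComplexConjugate Set

namespace Literature.NumberTheory.LFunctions.Zhang2022

namespace Det

open Repair BStar2Cert

/-! ### The three Schur identities at a point (complex-norm bookkeeping) -/

/-- `Re(12/5 − 12i/5) = 12/5`. [folklore] -/
private theorem re_m0' : ((12 / 5 - 12 / 5 * I : ℂ)).re = 12 / 5 := by norm_num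

/-- `‖a + ib‖² = a² + b²` for real `a, b`. [folklore] -/
private theorem normSq_re_add_im' (a b : ℝ) : ‖(a : ℂ) + I * b‖ ^ 2 = a ^ 2 + b ^ 2 := by
  rw [Complex.sq_norm, Complex.normSq_apply]; simp [sq]

/-- `Re(a + ib) = a`. [folklore] -/
private theorem re_re_add_im' (a b : ℝ) : ((a : ℂ) + I * b).re = a := by simp

/-- `(A + iB) − (c + id)(e + if)/r` in components (`r` real). [folklore] -/
private theorem sub_mul_div_ofReal' (A B c d e f r : ℝ) :
    ((A : ℂ) + I * B) - ((c : ℂ) + I * d) * ((e : ℂ) + I * f) / (r : ℂ)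
      = (((A - (c * e - d * f) / r : ℝ)) : ℂ) + I * (((B - (c * f + d * e) / r : ℝ)) : ℂ) := by
  apply Complex.ext <;>
    simp only [Complex.add_re, Complex.add_im, Complex.sub_re, Complex.sub_im, Complex.mul_re, Complex.mul_im,
      Complex.div_ofReal_re, Complex.div_ofReal_im, Complex.ofReal_re, Complex.ofReal_im, Complex.I_re,
      Complex.I_im] <;>
    ring

/-- `k₁₂(y)` in components. [folklore] -/
private theorem k12c_eq (y : ℝ) :
    k12c y = ((π * Pre (lam * y) : ℝ) : ℂ) + I * ((π * Pim (lam * y) : ℝ) : ℂ) := by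
  unfold k12c; push_cast; ring

/-- `k₁₂′(y)` in components. [folklore] -/
private theorem k12d_eq (y : ℝ) :
    k12d y = ((π * (lam * Pred (lam * y)) : ℝ) : ℂ) + I * ((π * (lam * Pimd (lam * y)) : ℝ) : ℂ) := by
  unfold k12d; push_cast; ring

/-- the coupling `p₂ = k₂₂ + i(conj m_s + m_b)` in components: `(k₂₂ − 2) + (72/5)i`. [folklore] -/
private theorem p2_eq (y : ℝ) :
    (k22c y : ℂ) + I * (conj (36 / 5 - 41 / 5 * I : ℂ) + (36 / 5 - 31 / 5 * I))
      = ((k22c y - 2 : ℝ) : ℂ) + I * ((72 / 5 : ℝ) : ℂ) := by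
  apply Complex.ext <;>
  · simp only [Complex.add_re, Complex.add_im, Complex.mul_re, Complex.mul_im, Complex.sub_re, Complex.sub_im,
      Complex.I_re, Complex.I_im, Complex.conj_re, Complex.conj_im, Complex.ofReal_re, Complex.ofReal_im,
      Complex.div_ofNat_re, Complex.div_ofNat_im, Complex.re_ofNat, Complex.im_ofNat]
    ring

/-- the block entry `q₁₂ = iπ²m_bn + k₁₂′ − k₁₁` in components. [folklore] -/
private theorem q12_eq (y : ℝ) :
    I * π ^ 2 * (9 - 9 * I : ℂ) + k12d y - (k11c y : ℂ)
      = ((π ^ 2 * 9 + π * (lam * Pred (lam * y)) - π ^ 2 * P11 (lam * y) : ℝ) : ℂ)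
        + I * ((π ^ 2 * 9 + π * (lam * Pimd (lam * y)) : ℝ) : ℂ) := by
  rw [k12d_eq, show (π : ℂ) ^ 2 = ((π ^ 2 : ℝ) : ℂ) by push_cast; ring]
  unfold k11c
  apply Complex.ext
  · simp only [Complex.add_re, Complex.sub_re, Complex.mul_re, Complex.mul_im, Complex.sub_im,
      Complex.ofReal_re, Complex.ofReal_im, Complex.I_re, Complex.I_im, Complex.re_ofNat, Complex.im_ofNat]
    ring
  · simp only [Complex.sub_re, Complex.mul_re, Complex.mul_im, Complex.add_im, Complex.sub_im,
      Complex.ofReal_re, Complex.ofReal_im, Complex.I_re, Complex.I_im, Complex.re_ofNat, Complex.im_ofNat]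
    ring

/-- `s₁₁ = π³·S11e`. [cite: Zhang2022LandauSiegel, Prop 7.1 p.44] -/
private theorem schur11 (y : ℝ) :
    k11d y - ‖conj (k12c y)‖ ^ 2 / (2 / π * ((12 / 5 - 12 / 5 * I : ℂ)).re) = π ^ 3 * S11e (lam * y) := by
  rw [re_m0', Complex.norm_conj, k12c_eq, normSq_re_add_im']
  have hπ : π ≠ 0 := Real.pi_ne_zero
  unfold k11d S11e lam
  field_simp
  ring

/-- `s₂₂ = π·S22e`. [cite: Zhang2022LandauSiegel, Prop 7.1 p.44] -/
private theorem schur22 (y : ℝ) :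
    2 * π * ((3 - 3 * I : ℂ) + (108 / 5 - 108 / 5 * I)).re + k22d y - 2 * (k12c y).re
        - ‖(k22c y : ℂ) + I * (conj (36 / 5 - 41 / 5 * I : ℂ) + (36 / 5 - 31 / 5 * I))‖ ^ 2
          / (2 / π * ((12 / 5 - 12 / 5 * I : ℂ)).re)
      = π * S22e (lam * y) := by
  have h1 : (((3 - 3 * I : ℂ) + (108 / 5 - 108 / 5 * I))).re = 123 / 5 := by simp; norm_num
  rw [re_m0', h1, p2_eq, normSq_re_add_im', k12c_eq, re_re_add_im']
  have hπ : π ≠ 0 := Real.pi_ne_zero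
  unfold k22d k22c S22e lam
  field_simp
  ring

/-- `|s₁₂|² = π⁴·(S12re² + S12im²)`. [cite: Zhang2022LandauSiegel, Prop 7.1 p.44] -/
private theorem schur12 (y : ℝ) :
    ‖(I * π ^ 2 * (9 - 9 * I : ℂ) + k12d y - (k11c y : ℂ))
        - conj (conj (k12c y)) * ((k22c y : ℂ) + I * (conj (36 / 5 - 41 / 5 * I : ℂ) + (36 / 5 - 31 / 5 * I)))
          / ((2 / π * ((12 / 5 - 12 / 5 * I : ℂ)).re : ℝ) : ℂ)‖ ^ 2
      = π ^ 4 * (S12re (lam * y) ^ 2 + S12im (lam * y) ^ 2) := by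
  rw [re_m0', Complex.conj_conj, q12_eq, k12c_eq, p2_eq, sub_mul_div_ofReal', normSq_re_add_im']
  have hπ : π ≠ 0 := Real.pi_ne_zero
  unfold k22c S12re S12im lam
  field_simp
  ring

/-! ### The theorem -/

/-- **The E-010 slot at `b⋆⋆ = (1/2; 5/2, 3)` is a theorem: `𝔅_{b⋆⋆} ≥ 0` on one-sided kinked profiles.**
Proof = `Det.formDetPSD_of_certificate` with the explicit polynomial certificate `(k₁₁, k₂₂, k₁₂)` of
`RepairDetShiftPSDCertHalfFiveHalvesThree`: the pointwise form is the `3 × 3` Hermitian form of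
`certForm_eq_hermForm3` with pivot `24/(5π) > 0` and Schur data `s₁₁ = π³·S11e > 0`, `det = π⁴·DETe ≥ 0`
(`schur11/22/12`, `S11e_ge`, `DETe_nonneg` — barrier-num's certified numerators), and the boundary form is the
diagonal positive form `π²(3/5)|a|² + (3/5)|b|²`. [cite: Zhang2022LandauSiegel, §7 Prop. 7.1 p.44; §2 (2.16), Lemma 2.3] -/
theorem formDetPSD_shiftRecipe_bStar2 : FormDetPSD (shiftRecipe bStar2) := by
  obtain ⟨hm0, hms, hmn, hmb, hmbs, hmbn⟩ := moments_bStar2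
  refine formDetPSD_of_certificate k11c k22c k11d k22d k12c k12d hasDerivAt_k11c hasDerivAt_k22c
    hasDerivAt_k12c continuous_k11d continuous_k22d continuous_k12d ?_ ?_
  · intro y hy w v u
    have ht0 : 0 ≤ lam * y := mul_nonneg lam_pos.le hy.1
    have ht1 : lam * y ≤ 1 :=
      (mul_le_mul_of_nonneg_left hy.2 lam_pos.le).trans (by rw [mul_one]; exact lam_le_one)
    rw [certForm_eq_hermForm3, hm0, hms, hmn, hmb, hmbs, hmbn]
    refine hermForm3_nonneg_of_schur (r := 2 / π * ((12 / 5 - 12 / 5 * I : ℂ)).re) (q11 := k11d y)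
      (q22 := 2 * π * ((3 - 3 * I : ℂ) + (108 / 5 - 108 / 5 * I)).re + k22d y - 2 * (k12c y).re)
      (p1 := conj (k12c y)) (p2 := (k22c y : ℂ) + I * (conj (36 / 5 - 41 / 5 * I : ℂ) + (36 / 5 - 31 / 5 * I)))
      (q12 := I * π ^ 2 * (9 - 9 * I : ℂ) + k12d y - (k11c y : ℂ)) ?_ ?_ ?_ w v u
    · rw [re_m0']; positivity
    · rw [schur11]; exact mul_pos (by positivity) (by linarith [S11e_ge ht0 ht1])
    · rw [schur11, schur22, schur12]
      have hD := DETe_nonneg ht0 ht1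
      have e : π ^ 3 * S11e (lam * y) * (π * S22e (lam * y))
            - π ^ 4 * (S12re (lam * y) ^ 2 + S12im (lam * y) ^ 2)
          = π ^ 4 * DETe (lam * y) := by unfold DETe; ring
      rw [e]; exact mul_nonneg (by positivity) hD
  · intro a b
    simp only [bdForm]
    rw [hmn, k11c_zero, k22c_zero, k12c_zero]
    have e : π ^ 2 * (3 / 5) * ‖a‖ ^ 2
          + 2 * ((π : ℂ) * ((3 : ℂ) + I * (-3 : ℂ)) * (conj a * b)).re
          + 3 / 5 * ‖b‖ ^ 2 - 2 * π * ((3 - 3 * I : ℂ) * (b * conj a)).re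
        = π ^ 2 * (3 / 5) * ‖a‖ ^ 2 + 3 / 5 * ‖b‖ ^ 2 := by
      simp only [Complex.mul_re, Complex.mul_im, Complex.add_re, Complex.add_im, Complex.sub_re,
        Complex.sub_im, Complex.neg_re, Complex.neg_im, Complex.ofReal_re, Complex.ofReal_im, Complex.I_re,
        Complex.I_im, Complex.conj_re, Complex.conj_im, Complex.re_ofNat, Complex.im_ofNat]
      ring
    rw [e]; positivity

/-- The same statement with the triple displayed. [cite: Zhang2022LandauSiegel, §7 Prop. 7.1 p.44; §2 Lemma 2.3] -/
theorem formDetPSD_shiftRecipe_half_fiveHalves_three : FormDetPSD (shiftRecipe ![1 / 2, 5 / 2, 3]) :=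
  formDetPSD_shiftRecipe_bStar2

end Det

/-! ### Consequence for the §E family `familyDetShift`: the verdict is UNCONDITIONAL at `b⋆⋆` -/

namespace Repair

open Det Det.BStar2Cert

/-- **At the detector `b⋆⋆ = (1/2; 5/2, 3)` no pair of one-sided kinked legs closes the joint main-order
criterion** — the displayed slot of `RepairDetShift` discharged: `¬ (𝔅_{b⋆⋆}(u)·𝔅_{b⋆⋆}(f) < ‖P_{b⋆⋆}(u,f)‖²)`.
[cite: Zhang2022LandauSiegel, §2 (2.18), Props. 2.4–2.6, (2.32)–(2.33)] -/
theorem detShift_verdict_bStar2 {u u' f f' : ℝ → ℂ} (hu : KinkedProfile u u') (hf : KinkedProfile f f')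
    (hu1 : u 1 = 0) (hf1 : f 1 = 0) :
    ¬ (FormDet (shiftRecipe bStar2) u u' * FormDet (shiftRecipe bStar2) f f'
        < ‖FormDetPolar (shiftRecipe bStar2) u u' f f'‖ ^ 2) :=
  not_trueNeed_of_psd formDetPSD_shiftRecipe_bStar2 hu hf hu1 hf1

/-- Every member of `familyDetShift` with `b = b⋆⋆` satisfies the verdict's conclusion outright.
[cite: Zhang2022LandauSiegel, §2 (2.18), (2.32)–(2.33)] -/
theorem detShift_unconditional_bStar2 (d : DetShiftDesign) (h : d.InClass) (hb : d.b = bStar2) :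
    ¬ (FormDet (shiftRecipe d.b) d.u d.u' * FormDet (shiftRecipe d.b) d.f d.f'
        < ‖FormDetPolar (shiftRecipe d.b) d.u d.u' d.f d.f'‖ ^ 2) :=
  not_repairable_detShift d h (hb ▸ formDetPSD_shiftRecipe_bStar2)

/-- Non-vacuity: the `𝔡`- and `𝔡′`-block legs of the printed design `θ₀` under the detector `b⋆⋆` are members.
[cite: Zhang2022LandauSiegel, §2 (2.13), (2.21)–(2.28)] -/
theorem inClass_legs_theta0_bStar2 : (dLeg bStar2 theta0).InClass ∧ (dPrimeLeg bStar2 theta0).InClass :=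
  ⟨inClass_dLeg signAdmissible_bStar2 admissible_theta0.toCalc,
    inClass_dPrimeLeg signAdmissible_bStar2 admissible_theta0.toCalc⟩

/-- **The discharged set so far**: the E-010 slot of `familyDetShift` is a tree theorem at the three triples
`(1,2,3)`, `b⋆ = (1/2; 2, 5/2)`, `b⋆⋆ = (1/2; 5/2, 3)` — the row text «CONDITIONAL on E-010 off {(1,2,3), b⋆, b⋆⋆}».
[cite: Zhang2022LandauSiegel, §7 Prop. 7.1 p.44; §2 Lemma 2.3] -/
theorem formDetPSD_shiftRecipe_discharged :
    FormDetPSD (shiftRecipe ![1, 2, 3]) ∧ FormDetPSD (shiftRecipe bStar) ∧ FormDetPSD (shiftRecipe bStar2) :=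
  ⟨formDetPSD_shiftRecipe_std, formDetPSD_shiftRecipe_bStar, formDetPSD_shiftRecipe_bStar2⟩

end Repair

end Literature.NumberTheory.LFunctions.Zhang2022
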